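import Mathlib.MeasureTheory.Measure.Haar.Disintegration
import HarnessLib

/-!
# Linear submersion bound: `∫_K g (L v) dμ ≤ C · ∫_{L K} g dν` for a surjective linear map

Topic `Literature/MeasureTheory/Group` (sibling ★ `LocalFieldLinearJacobian` — the bijective case `μ (L S) = mod(det L) μ S`);
namespace `Literature.MeasureTheory.Group`.  THEOREMS ONLY (no definition ∕ instance ∕ notation ∕ named fact ∕ `sorry`);
imports Mathlib + `HarnessLib`.  Cell `pub/hodgecm-mathlib`, crux H413 = `stmt-HodgeConjecture-24833` (lane `--supports`,
count-neutral): brick **(D2-lin) «LINEAR SUBMERSION BOUND»** of the ROAD «HC-D» (holder F0P2-p01 (g23); consumer: FILE 2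
`F0P3cStCharTSStrictDerivNewton` ∕ D2 «a strictly differentiable chart with surjective differential integrates like its
linearisation»), seat LH10-p01 (g7), 2026-09-02.  HONEST LABEL: HC_CM is proved only modulo the 7 printed citations
(2 remaining: hLiu418 = `stmt-HodgeConjecture-24832`, h413 = `stmt-HodgeConjecture-24833`) until rung 0 closes; this file
closes no organ.

## The statement

Let `𝕜` be a complete nontrivially normed field (`ℝ`, `ℂ`, or a non-archimedean local field `K_v` through
`Valued.toNontriviallyNormedField`), `E`, `F` normed `𝕜`-spaces with `E` locally compact (so both are finite dimensional as
soon as `L` below is onto), `μ`, `ν` additive Haar measures on `E`, `F`, and `L : E →ₗ[𝕜] F` a SURJECTIVE linear map.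
Mathlib's `LinearMap.exists_map_addHaar_eq_smul_addHaar'` says `L_* μ = (c · addHaar (ker L)) • ν` — exact, but the factor
is `∞` whenever `ker L ≠ 0`.  The usable local form: for every COMPACT `K ⊆ E` there is a FINITE constant `C` (depending on
`K`, `L`, `μ`, `ν`, not on the integrand) with

  **`∫⁻ v in K, g (L v) ∂μ ≤ C * ∫⁻ a in L '' K, g a ∂ν`**   for every `ν`-a.e.-measurable `g : F → ℝ≥0∞`

(`exists_setLIntegral_comp_le_mul_setLIntegral_image`), equivalently the measure inequality
`(μ.restrict K).map L ≤ C • ν.restrict (L '' K)` (`exists_map_restrict_le_smul_restrict_image`); and the transport to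
carriers `V`, `A` that are only topological `𝕜`-modules with continuous linear trivialisations `V ≃L[𝕜] E`, `A ≃L[𝕜] F`
(`…_of_trivialization`, the currency of ★ `LocalFieldLinearJacobian` §4).

## The proof (Mathlib's, localised)

Choose a complement `T` of `S = ker L` (`Submodule.exists_isCompl`); `M : S × T ≃ E`, `(s, t) ↦ s + t`, is a continuous
linear isomorphism, `μ = c₀ • M_* (addHaar_S ⊗ addHaar_T)` by uniqueness of Haar measure, `L ∘ M = L' ∘ snd` with
`L' : T ≃ F` and `L'_* addHaar_T = c₁ • ν`.  On `K` the `S`-coordinate lies in the compact set `K₁ = fst (M⁻¹ K)`, so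
pointwise `1_K · (g ∘ L) ∘ M ≤ 1_{K₁} ⊗ (1_{L K} · g) ∘ L'` and Tonelli gives `C = c₀ · addHaar_S K₁ · c₁ < ∞`.
Not treated: the non-linear statement (D2 proper, the consumer's file) and non-measurable integrands.
-/

set_option autoImplicit false

noncomputable section

open MeasureTheory MeasureTheory.Measure Set
open scoped ENNReal

namespace Literature.MeasureTheory.Group

section Normed

variable {𝕜 E F : Type*}
  [NontriviallyNormedField 𝕜] [CompleteSpace 𝕜]
  [NormedAddCommGroup E] [MeasurableSpace E] [BorelSpace E] [NormedSpace 𝕜 E]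
  [NormedAddCommGroup F] [MeasurableSpace F] [BorelSpace F] [NormedSpace 𝕜 F]
  [LocallyCompactSpace E]
  (L : E →ₗ[𝕜] F) (μ : Measure E) (ν : Measure F) [IsAddHaarMeasure μ] [IsAddHaarMeasure ν]

/-- The linear submersion bound for MEASURABLE integrands (the core computation; the public statements below remove the
measurability restriction to `ν`-a.e. measurability and rephrase it as a measure inequality). [folklore] -/
private theorem exists_setLIntegral_comp_le_of_measurable (h : Function.Surjective L) {K : Set E}
    (hK : IsCompact K) :
    ∃ C : ℝ≥0∞, C < ∞ ∧ ∀ g : F → ℝ≥0∞, Measurable g →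
      ∫⁻ v in K, g (L v) ∂μ ≤ C * ∫⁻ a in L '' K, g a ∂ν := by
  have : FiniteDimensional 𝕜 E := .of_locallyCompactSpace 𝕜
  have : ProperSpace F := by
    rcases subsingleton_or_nontrivial E with hE | hE
    · have : Subsingleton F := Function.Surjective.subsingleton h
      infer_instance
    · have : ProperSpace 𝕜 := .of_locallyCompact_module 𝕜 E
      have : FiniteDimensional 𝕜 F := Module.Finite.of_surjective L h
      exact FiniteDimensional.proper 𝕜 F
  have L_cont : Continuous L := LinearMap.continuous_of_finiteDimensional _
  let S : Submodule 𝕜 E := LinearMap.ker L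
  obtain ⟨T, hT⟩ : ∃ T : Submodule 𝕜 E, IsCompl S T := Submodule.exists_isCompl S
  let M : (S × T) ≃ₗ[𝕜] E := Submodule.prodEquivOfIsCompl S T hT
  let Mc : (S × T) ≃L[𝕜] E := M.toContinuousLinearEquiv
  let Me : (S × T) ≃ᵐ E := Mc.toHomeomorph.toMeasurableEquiv
  have hMe : ∀ p, Me p = M p := fun _ => rfl
  have I : Function.Bijective (LinearMap.domRestrict L T) :=
    ⟨LinearMap.injective_domRestrict_iff.2 hT.disjoint.symm,
    (LinearMap.surjective_domRestrict_iff h).2 hT.symm.codisjoint⟩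
  let L' : T ≃ₗ[𝕜] F := LinearEquiv.ofBijective (LinearMap.domRestrict L T) I
  have L'_cont : Continuous L' := LinearMap.continuous_of_finiteDimensional _
  have hLM : ∀ p : S × T, L (M p) = L' p.2 := by
    rintro ⟨y, z⟩
    have hy : L y = 0 := y.2
    simp [M, L', hy]
  let μS : Measure S := addHaar
  let μT : Measure T := addHaar
  obtain ⟨c₀, -, c₀_fin, h₀⟩ :
      ∃ c₀ : ℝ≥0∞, c₀ ≠ 0 ∧ c₀ ≠ ∞ ∧ μ.map M.symm = c₀ • μS.prod μT := by
    have : IsAddHaarMeasure (μ.map M.symm) :=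
      M.toContinuousLinearEquiv.symm.isAddHaarMeasure_map μ
    refine ⟨addHaarScalarFactor (μ.map M.symm) (μS.prod μT), ?_, ENNReal.coe_ne_top,
      isAddLeftInvariant_eq_smul _ _⟩
    simpa only [ne_eq, ENNReal.coe_eq_zero] using
      (addHaarScalarFactor_pos_of_isAddHaarMeasure (μ.map M.symm) (μS.prod μT)).ne'
  obtain ⟨c₁, -, c₁_fin, h₁⟩ : ∃ c₁ : ℝ≥0∞, c₁ ≠ 0 ∧ c₁ ≠ ∞ ∧ μT.map L' = c₁ • ν := by
    have : IsAddHaarMeasure (μT.map L') :=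
      L'.toContinuousLinearEquiv.isAddHaarMeasure_map μT
    refine ⟨addHaarScalarFactor (μT.map L') ν, ?_, ENNReal.coe_ne_top,
      isAddLeftInvariant_eq_smul _ _⟩
    simpa only [ne_eq, ENNReal.coe_eq_zero] using
      (addHaarScalarFactor_pos_of_isAddHaarMeasure (μT.map L') ν).ne'
  -- `μ` itself is the push-forward of `c₀ • μS.prod μT` along `M`
  have hμ : μ = (c₀ • μS.prod μT).map Me := by
    have : μ.map M.symm = μ.map Me.symm := rfl
    rw [← h₀, this, MeasurableEquiv.map_map_symm]
  -- the compact set of `ker L`-coordinates of `K`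
  let K₁ : Set S := (fun v => (Me.symm v).1) '' K
  have hK₁ : IsCompact K₁ := hK.image (continuous_fst.comp Mc.toHomeomorph.symm.continuous)
  have hK₁m : MeasurableSet K₁ := hK₁.isClosed.measurableSet
  have hLK : MeasurableSet (L '' K) := (hK.image L_cont).isClosed.measurableSet
  refine ⟨c₀ * (μS K₁ * c₁), ?_, fun g hg => ?_⟩
  · exact ENNReal.mul_lt_top c₀_fin.lt_top (ENNReal.mul_lt_top hK₁.measure_lt_top c₁_fin.lt_top)
  -- pointwise domination on `S × T`
  let φ₁ : S → ℝ≥0∞ := K₁.indicator 1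
  let φ₂ : T → ℝ≥0∞ := fun t => (L '' K).indicator g (L' t)
  have hφ₁ : Measurable φ₁ := measurable_const.indicator hK₁m
  have hφ₂ : Measurable φ₂ := (hg.indicator hLK).comp L'_cont.measurable
  have hdom : ∀ p : S × T, K.indicator (fun v => g (L v)) (Me p) ≤ φ₁ p.1 * φ₂ p.2 := by
    intro p
    by_cases hp : Me p ∈ K
    · have h1 : p.1 ∈ K₁ := ⟨Me p, hp, by simp⟩
      have h2 : L' p.2 ∈ L '' K := ⟨Me p, hp, by rw [hMe, hLM]⟩
      simp only [φ₁, φ₂]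
      rw [indicator_of_mem hp, indicator_of_mem h1, indicator_of_mem h2, hMe, hLM, Pi.one_apply, one_mul]
    · rw [indicator_of_notMem hp]; exact bot_le
  calc ∫⁻ v in K, g (L v) ∂μ
      = ∫⁻ v, K.indicator (fun v => g (L v)) v ∂μ := (lintegral_indicator hK.isClosed.measurableSet _).symm
    _ = c₀ * ∫⁻ p, K.indicator (fun v => g (L v)) (Me p) ∂(μS.prod μT) := by
        rw [hμ, lintegral_map_equiv, lintegral_smul_measure, smul_eq_mul]
    _ ≤ c₀ * ∫⁻ p, φ₁ p.1 * φ₂ p.2 ∂(μS.prod μT) := by gcongr c₀ * ?_; exact lintegral_mono hdom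
    _ = c₀ * (μS K₁ * ∫⁻ t, φ₂ t ∂μT) := by
        rw [lintegral_prod_mul hφ₁.aemeasurable hφ₂.aemeasurable]
        rw [lintegral_indicator_one hK₁m]
    _ = c₀ * (μS K₁ * (c₁ * ∫⁻ a in L '' K, g a ∂ν)) := by
        simp only [φ₂]
        rw [← lintegral_map (hg.indicator hLK) L'_cont.measurable, h₁, lintegral_smul_measure, smul_eq_mul,
          lintegral_indicator hLK]
    _ = c₀ * (μS K₁ * c₁) * ∫⁻ a in L '' K, g a ∂ν := by ring

/-- **Quotient integral formula for a surjective linear map** (Weil's formula in the vector-group case `G = E`,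
`H = ker L`, `G ∕ H ≅ F`).  For a SURJECTIVE linear map `L : E →ₗ[𝕜] F` (normed spaces over a complete nontrivially normed
field, `E` locally compact) and additive Haar measures `μ` on `E`, `ν` on `F`, there are a linear SECTION `σ : F →ₗ[𝕜] E` of
`L` and a constant `0 < c < ∞` such that for every measurable `f : E → ℝ≥0∞`

  `∫⁻ x, f x ∂μ = c * ∫⁻ a, (∫⁻ s, f (s + σ a) ∂ addHaar_{ker L}) ∂ν`

— integrate first over the fibres `L⁻¹(a) = ker L + σ a` against the Haar measure of `ker L`, then over the base against `ν`.
(The book states it for a closed subgroup `H` of a locally compact group `G` with `Δ_G|_H = Δ_H` and the quotient measure on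
`G ∕ H`; here `G ∕ H` is identified with `F` through `L`, and the quotient measure with `c • ν` by uniqueness of Haar measure.)
[cite: DeitmarEchterhoff2014, Thm. 1.5.3 (§1.5 quotient integral formula; linear special case, held text p0064)] -/
theorem exists_lintegral_eq_mul_lintegral_lintegral_ker (h : Function.Surjective L) :
    ∃ (c : ℝ≥0∞) (σ : F →ₗ[𝕜] E), c ≠ 0 ∧ c ≠ ∞ ∧ (∀ a, L (σ a) = a) ∧
      ∀ f : E → ℝ≥0∞, Measurable f →
        ∫⁻ x, f x ∂μ = c * ∫⁻ a, ∫⁻ s, f ((s : E) + σ a) ∂(addHaar : Measure (LinearMap.ker L)) ∂ν := by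
  have : FiniteDimensional 𝕜 E := .of_locallyCompactSpace 𝕜
  have : ProperSpace F := by
    rcases subsingleton_or_nontrivial E with hE | hE
    · have : Subsingleton F := Function.Surjective.subsingleton h
      infer_instance
    · have : ProperSpace 𝕜 := .of_locallyCompact_module 𝕜 E
      have : FiniteDimensional 𝕜 F := Module.Finite.of_surjective L h
      exact FiniteDimensional.proper 𝕜 F
  let S : Submodule 𝕜 E := LinearMap.ker L
  obtain ⟨T, hT⟩ : ∃ T : Submodule 𝕜 E, IsCompl S T := Submodule.exists_isCompl S
  let M : (S × T) ≃ₗ[𝕜] E := Submodule.prodEquivOfIsCompl S T hT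
  let Mc : (S × T) ≃L[𝕜] E := M.toContinuousLinearEquiv
  let Me : (S × T) ≃ᵐ E := Mc.toHomeomorph.toMeasurableEquiv
  have hMe : ∀ p : S × T, Me p = (p.1 : E) + p.2 := fun p => by
    change M p = _
    simp [M]
  have I : Function.Bijective (LinearMap.domRestrict L T) :=
    ⟨LinearMap.injective_domRestrict_iff.2 hT.disjoint.symm,
    (LinearMap.surjective_domRestrict_iff h).2 hT.symm.codisjoint⟩
  let L' : T ≃ₗ[𝕜] F := LinearEquiv.ofBijective (LinearMap.domRestrict L T) I
  let L'c : T ≃L[𝕜] F := L'.toContinuousLinearEquiv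
  let L'e : T ≃ᵐ F := L'c.toHomeomorph.toMeasurableEquiv
  have hL'e : ∀ t, L'e t = L' t := fun _ => rfl
  let μS : Measure S := addHaar
  let μT : Measure T := addHaar
  obtain ⟨c₀, c₀_pos, c₀_fin, h₀⟩ :
      ∃ c₀ : ℝ≥0∞, c₀ ≠ 0 ∧ c₀ ≠ ∞ ∧ μ.map M.symm = c₀ • μS.prod μT := by
    have : IsAddHaarMeasure (μ.map M.symm) :=
      M.toContinuousLinearEquiv.symm.isAddHaarMeasure_map μ
    refine ⟨addHaarScalarFactor (μ.map M.symm) (μS.prod μT), ?_, ENNReal.coe_ne_top,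
      isAddLeftInvariant_eq_smul _ _⟩
    simpa only [ne_eq, ENNReal.coe_eq_zero] using
      (addHaarScalarFactor_pos_of_isAddHaarMeasure (μ.map M.symm) (μS.prod μT)).ne'
  obtain ⟨c₁, c₁_pos, c₁_fin, h₁⟩ : ∃ c₁ : ℝ≥0∞, c₁ ≠ 0 ∧ c₁ ≠ ∞ ∧ μT.map L' = c₁ • ν := by
    have : IsAddHaarMeasure (μT.map L') := L'c.isAddHaarMeasure_map μT
    refine ⟨addHaarScalarFactor (μT.map L') ν, ?_, ENNReal.coe_ne_top,
      isAddLeftInvariant_eq_smul _ _⟩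
    simpa only [ne_eq, ENNReal.coe_eq_zero] using
      (addHaarScalarFactor_pos_of_isAddHaarMeasure (μT.map L') ν).ne'
  have hμ : μ = (c₀ • μS.prod μT).map Me := by
    have : μ.map M.symm = μ.map Me.symm := rfl
    rw [← h₀, this, MeasurableEquiv.map_map_symm]
  -- `ν = c₁⁻¹ • L'_* μT`, as a push-forward along the measurable equivalence `L'e`
  have hν : ν = (c₁⁻¹ • μT).map L'e := by
    have e1 : μT.map L'e = c₁ • ν := h₁
    rw [Measure.map_smul, e1, smul_smul, ENNReal.inv_mul_cancel c₁_pos c₁_fin, one_smul]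
  let σ : F →ₗ[𝕜] E := T.subtype.comp (L'.symm : F →ₗ[𝕜] T)
  have hσ : ∀ a, L (σ a) = a := fun a => by
    have e1 : L (σ a) = L' (L'.symm a) := rfl
    rw [e1, LinearEquiv.apply_symm_apply]
  refine ⟨c₀ * c₁, σ, mul_ne_zero c₀_pos c₁_pos, ENNReal.mul_ne_top c₀_fin c₁_fin, hσ, fun f hf => ?_⟩
  have hcM : Continuous fun p : S × T => (p.1 : E) + p.2 :=
    (continuous_subtype_val.comp continuous_fst).add (continuous_subtype_val.comp continuous_snd)
  have hfM : Measurable fun p : S × T => f ((p.1 : E) + p.2) := hf.comp hcM.measurable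
  calc ∫⁻ x, f x ∂μ = c₀ * ∫⁻ p, f ((p.1 : E) + p.2) ∂(μS.prod μT) := by
        rw [hμ, lintegral_map_equiv, lintegral_smul_measure, smul_eq_mul]
        simp only [hMe]
    _ = c₀ * ∫⁻ t, ∫⁻ s, f ((s : E) + t) ∂μS ∂μT := by
        rw [lintegral_prod _ hfM.aemeasurable, lintegral_lintegral_swap hfM.aemeasurable]
    _ = c₀ * (c₁ * ∫⁻ a, ∫⁻ s, f ((s : E) + σ a) ∂μS ∂ν) := by
        congr 1
        rw [hν, lintegral_map_equiv, lintegral_smul_measure, smul_eq_mul, ← mul_assoc,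
          ENNReal.mul_inv_cancel c₁_pos c₁_fin, one_mul]
        refine lintegral_congr fun t => lintegral_congr fun s => ?_
        have e1 : σ (L'e t) = ((L'.symm (L' t) : T) : E) := rfl
        rw [e1, LinearEquiv.symm_apply_apply]
    _ = c₀ * c₁ * ∫⁻ a, ∫⁻ s, f ((s : E) + σ a) ∂μS ∂ν := by ring

/-- **Linear submersion bound, measure form.**  For a SURJECTIVE linear map `L : E →ₗ[𝕜] F` between normed spaces over a
complete nontrivially normed field (`E` locally compact), additive Haar measures `μ` on `E` and `ν` on `F`, and a compact
set `K ⊆ E`, the push-forward of `μ|_K` along `L` is dominated by a FINITE multiple of `ν|_{L K}`: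
`(μ.restrict K).map L ≤ C • ν.restrict (L '' K)` with `C < ∞`.  (Global form with a possibly infinite factor:
Mathlib `LinearMap.exists_map_addHaar_eq_smul_addHaar'`.)  This is the vector-group case `G = E`, `H = ker L`,
`G ∕ H ≅ F` of the quotient integral formula, localised to a compact set.
[cite: DeitmarEchterhoff2014, Thm. 1.5.3 (§1.5 quotient integral formula; linear special case, held text p0064)] -/
theorem exists_map_restrict_le_smul_restrict_image (h : Function.Surjective L) {K : Set E} (hK : IsCompact K) :
    ∃ C : ℝ≥0∞, C < ∞ ∧ (μ.restrict K).map L ≤ C • ν.restrict (L '' K) := by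
  have : FiniteDimensional 𝕜 E := .of_locallyCompactSpace 𝕜
  have L_meas : Measurable L := (LinearMap.continuous_of_finiteDimensional L).measurable
  obtain ⟨C, hC, hle⟩ := exists_setLIntegral_comp_le_of_measurable L μ ν h hK
  refine ⟨C, hC, Measure.le_iff.2 fun s hs => ?_⟩
  have key := hle (s.indicator 1) (measurable_one.indicator hs)
  have e : (fun v => s.indicator (1 : F → ℝ≥0∞) (L v)) = (L ⁻¹' s).indicator 1 := by
    funext v
    by_cases hv : L v ∈ s
    · rw [indicator_of_mem hv, indicator_of_mem (show v ∈ L ⁻¹' s from hv), Pi.one_apply, Pi.one_apply]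
    · rw [indicator_of_notMem hv, indicator_of_notMem (show v ∉ L ⁻¹' s from hv)]
  rw [e, lintegral_indicator_one (L_meas hs), lintegral_indicator_one hs] at key
  rw [map_apply L_meas hs, Measure.smul_apply, smul_eq_mul]
  exact key

/-- **Linear submersion bound.**  For a SURJECTIVE linear map `L : E →ₗ[𝕜] F` between normed spaces over a complete
nontrivially normed field (`E` locally compact — e.g. `𝕜 = ℝ`, `ℂ`, or a non-archimedean local field), additive Haar measures
`μ`, `ν` and a COMPACT set `K ⊆ E`, there is a finite constant `C` (depending on `K`, `L`, `μ`, `ν` only) with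
`∫⁻ v in K, g (L v) ∂μ ≤ C * ∫⁻ a in L '' K, g a ∂ν` for every `ν`-a.e. measurable `g : F → ℝ≥0∞`.  (For a continuous
linear `P : E →L[𝕜] F` apply it to `(P : E →ₗ[𝕜] F)`.)  Corollary of the quotient integral formula
`exists_lintegral_eq_mul_lintegral_lintegral_ker` (the fibre `{s ∈ ker L | s + σ a ∈ K}` has Haar measure at most that of
the compact projection `K₁`).
[cite: DeitmarEchterhoff2014, Thm. 1.5.3 (§1.5 quotient integral formula; linear special case, held text p0064)] -/
theorem exists_setLIntegral_comp_le_mul_setLIntegral_image (h : Function.Surjective L) {K : Set E}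
    (hK : IsCompact K) :
    ∃ C : ℝ≥0∞, C < ∞ ∧ ∀ g : F → ℝ≥0∞, AEMeasurable g ν →
      ∫⁻ v in K, g (L v) ∂μ ≤ C * ∫⁻ a in L '' K, g a ∂ν := by
  have : FiniteDimensional 𝕜 E := .of_locallyCompactSpace 𝕜
  have L_meas : Measurable L := (LinearMap.continuous_of_finiteDimensional L).measurable
  obtain ⟨C, hC, hle⟩ := exists_map_restrict_le_smul_restrict_image L μ ν h hK
  refine ⟨C, hC, fun g hg => ?_⟩
  have hac : (μ.restrict K).map L ≪ ν :=
    (Measure.absolutelyContinuous_of_le hle).trans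
      (smul_absolutelyContinuous.trans (Measure.absolutelyContinuous_of_le Measure.restrict_le_self))
  calc ∫⁻ v in K, g (L v) ∂μ = ∫⁻ a, g a ∂((μ.restrict K).map L) :=
        (lintegral_map' (hg.mono_ac hac) L_meas.aemeasurable).symm
    _ ≤ ∫⁻ a, g a ∂(C • ν.restrict (L '' K)) := lintegral_mono' hle le_rfl
    _ = C * ∫⁻ a in L '' K, g a ∂ν := by rw [lintegral_smul_measure, smul_eq_mul]

/-- **Linear submersion bound, continuous-linear-map spelling**: the statement of
`exists_setLIntegral_comp_le_mul_setLIntegral_image` for a surjective `P : E →L[𝕜] F` (e.g. a surjective strict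
derivative `P = φ′(x₀)`, the consumer's case).
[cite: DeitmarEchterhoff2014, Thm. 1.5.3 (§1.5 quotient integral formula; linear special case, held text p0064)] -/
theorem exists_setLIntegral_comp_le_mul_setLIntegral_image_continuousLinearMap (P : E →L[𝕜] F)
    (h : Function.Surjective P) {K : Set E} (hK : IsCompact K) :
    ∃ C : ℝ≥0∞, C < ∞ ∧ ∀ g : F → ℝ≥0∞, AEMeasurable g ν →
      ∫⁻ v in K, g (P v) ∂μ ≤ C * ∫⁻ a in P '' K, g a ∂ν :=
  exists_setLIntegral_comp_le_mul_setLIntegral_image (P : E →ₗ[𝕜] F) μ ν h hK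

end Normed

/-! ## Transport to carriers with a continuous linear trivialisation (the currency of ★ `LocalFieldLinearJacobian` §4:
the consumer's spaces are topological `𝕜`-modules with coordinates, not literally normed spaces) -/

section Trivialization

variable {𝕜 E F : Type*}
  [NontriviallyNormedField 𝕜] [CompleteSpace 𝕜]
  [NormedAddCommGroup E] [MeasurableSpace E] [BorelSpace E] [NormedSpace 𝕜 E]
  [NormedAddCommGroup F] [MeasurableSpace F] [BorelSpace F] [NormedSpace 𝕜 F]
  [LocallyCompactSpace E]
  {V A : Type*}
  [AddCommGroup V] [Module 𝕜 V] [TopologicalSpace V] [IsTopologicalAddGroup V] [MeasurableSpace V] [BorelSpace V]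
  [AddCommGroup A] [Module 𝕜 A] [TopologicalSpace A] [IsTopologicalAddGroup A] [MeasurableSpace A] [BorelSpace A]

/-- **Linear submersion bound on trivialised carriers.**  Let `V`, `A` be topological `𝕜`-modules (`𝕜` complete
nontrivially normed) with Borel σ-algebras, additive Haar measures `μV`, `μA`, and continuous linear trivialisations
`eV : V ≃L[𝕜] E`, `eA : A ≃L[𝕜] F` onto normed `𝕜`-spaces (`E` locally compact; typically `E = ι → 𝕜`, `F = κ → 𝕜`).
For a SURJECTIVE linear map `P : V →ₗ[𝕜] A` and a compact `K ⊆ V` there is `C < ∞` with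
`∫⁻ v in K, g (P v) ∂μV ≤ C * ∫⁻ a in P '' K, g a ∂μA` for every `μA`-a.e. measurable `g`.  (Transport of
`exists_setLIntegral_comp_le_mul_setLIntegral_image` along `eV`, `eA`.)
[cite: DeitmarEchterhoff2014, Thm. 1.5.3 (§1.5 quotient integral formula; linear special case, held text p0064)] -/
theorem exists_setLIntegral_comp_le_mul_setLIntegral_image_of_trivialization (eV : V ≃L[𝕜] E) (eA : A ≃L[𝕜] F)
    (P : V →ₗ[𝕜] A) (h : Function.Surjective P) (μV : Measure V) (μA : Measure A) [IsAddHaarMeasure μV]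
    [IsAddHaarMeasure μA] {K : Set V} (hK : IsCompact K) :
    ∃ C : ℝ≥0∞, C < ∞ ∧ ∀ g : A → ℝ≥0∞, AEMeasurable g μA →
      ∫⁻ v in K, g (P v) ∂μV ≤ C * ∫⁻ a in P '' K, g a ∂μA := by
  let L : E →ₗ[𝕜] F := (eA : A →ₗ[𝕜] F).comp (P.comp (eV.symm : E →ₗ[𝕜] V))
  have hL : Function.Surjective L := eA.surjective.comp (h.comp eV.symm.surjective)
  let eVm : V ≃ᵐ E := eV.toHomeomorph.toMeasurableEquiv
  let eAm : A ≃ᵐ F := eA.toHomeomorph.toMeasurableEquiv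
  have heVm : ∀ v, eVm v = eV v := fun _ => rfl
  have heAm : ∀ a, eAm a = eA a := fun _ => rfl
  have hLe : ∀ v, L (eV v) = eA (P v) := fun v => by simp [L]
  obtain ⟨C, hC, hle⟩ := exists_setLIntegral_comp_le_mul_setLIntegral_image L (μV.map eV) (μA.map eA) hL
    (hK.image eV.continuous)
  refine ⟨C, hC, fun g hg => ?_⟩
  -- the integrand on `F`
  have hg' : AEMeasurable (fun b => g (eA.symm b)) (μA.map eA) := by
    have hμ : (μA.map eAm).map eAm.symm = μA := MeasurableEquiv.map_symm_map eAm
    have : AEMeasurable g ((μA.map eAm).map eAm.symm) := by rwa [hμ]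
    exact this.comp_measurable eAm.symm.measurable
  have key := hle (fun b => g (eA.symm b)) hg'
  -- left-hand side: transport along `eV`
  have hKpre : eVm ⁻¹' (eV '' K) = K := by
    change eV ⁻¹' (eV '' K) = K
    exact eV.injective.preimage_image K
  have lhs : ∫⁻ x in eV '' K, g (eA.symm (L x)) ∂(μV.map eV) = ∫⁻ v in K, g (P v) ∂μV := by
    change ∫⁻ x in eV '' K, g (eA.symm (L x)) ∂(μV.map eVm) = _
    rw [MeasurableEquiv.restrict_map, lintegral_map_equiv, hKpre]
    refine lintegral_congr fun v => ?_
    rw [heVm, hLe, ContinuousLinearEquiv.symm_apply_apply]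
  -- right-hand side: transport along `eA`
  have hLK : L '' (eV '' K) = eA '' (P '' K) := by
    ext b
    simp only [mem_image, exists_exists_and_eq_and, hLe]
  have hPpre : eAm ⁻¹' (eA '' (P '' K)) = P '' K := by
    change eA ⁻¹' (eA '' (P '' K)) = P '' K
    exact eA.injective.preimage_image _
  have rhs : ∫⁻ b in L '' (eV '' K), g (eA.symm b) ∂(μA.map eA) = ∫⁻ a in P '' K, g a ∂μA := by
    change ∫⁻ b in L '' (eV '' K), g (eA.symm b) ∂(μA.map eAm) = _
    rw [hLK, MeasurableEquiv.restrict_map, lintegral_map_equiv, hPpre]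
    refine lintegral_congr fun a => ?_
    rw [heAm, ContinuousLinearEquiv.symm_apply_apply]
  rw [lhs, rhs] at key
  exact key

end Trivialization

end Literature.MeasureTheory.Group

end
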